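import Summits.ValiantsHypothesis.ValiantsHypothesis.Theorems.GrenetZeonDualUnipotentThreeHalvesHeavyTopCodimOneCountEq
import Summits.ValiantsHypothesis.ValiantsHypothesis.Theorems.GrenetZeonDualUnipotentThreeHalvesHeavyTopCodimOneArith
import Summits.ValiantsHypothesis.ValiantsHypothesis.Theorems.GrenetZeonDualUnipotentThreeHalvesHeavyTopCompositionBoundFiveSeven

/-!
# `GrenetZeon.DualUnipotentThreeHalves` (stmt-ValiantsHypothesis-24318), R2 heavy-top instrument — COROLLARY II port, step (L2-β, counting half):
# ONE `3`-BLOCK ⇒ `V' = HULL(W₀, I, W₂)` with FULL outer blocks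

Case (β) of the composition-chain route (crux note `CENSUS-THMC-UNIFORM-eng1g5.md` §8.5), the counting half: after coarsening the composition chain to
three levels `c` (below / at / above the unique `3`-block), a nilpotent `V'` of deficiency at most one that is `c`-block upper-triangular, with coarse
diagonal-block images `W₀ ≤ M_{a₀}`, `W₁ ≤ M₃` (`dim W₁ ≤ 2`, the irreducible plane), `W₂ ≤ M_{a₂}` (nilpotent), satisfies

`dim W₀ = C(a₀,2)`, `dim W₂ = C(a₂,2)`, `dim W₁ = 2`, `dim V' + 1 = C(m,2)`, and `V' = HULL(W₀, W₁, W₂)`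
(`A ∈ V' ↔ A` is `c`-block upper-triangular with blocks in `W₀, W₁, W₂`),

by ✓ `finrank_le_of_three_levels`, ✓ `choose_two_eq_three_levels`, Gerstenhaber's bound on `W₀, W₂`, and ✓ `mem_iff_of_three_levels`.  What then remains
(geometric half, successor): Gerstenhaber EQUALITY units on `W₀`, `W₂` (now of full dimension), the block-diagonal unit, and the re-indexing onto ✓ `towerHull`
via ✓ `reindex_fromBlocks_mem_towerHull_iff(_left)`.

* ★ `hull_of_deficiency_le_one` — the statement above.

Honest framing: counting; nothing here proves or refutes `HeavyTopLaw`, 24318, S3b or 8062; `VP ≠ VNP` is NOT proved.  No definitions.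
[val-idea-30 MEMO codim-one §0 COROLLARY II, tower branch; cell val-heavytop-census, eng-1 g5]
-/

noncomputable section

-- single-conjunct layout: Sub = Summit, duplicated namespace component intended
set_option linter.dupNamespace false

namespace Summit.ValiantsHypothesis.ValiantsHypothesis.Theorems.GrenetZeon.HeavyTopCodimOneHull

open Matrix
open Summit.ValiantsHypothesis.ValiantsHypothesis.Theorems.GrenetZeon.HeavyTopCodimOneCount (finrank_le_of_three_levels mem_iff_of_three_levels)
open Summit.ValiantsHypothesis.ValiantsHypothesis.Theorems.GrenetZeon.HeavyTopCodimOneArith (choose_two_eq_three_levels)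
open Literature.LinearAlgebra.Matrix.GerstenhaberNilpotentSubspace (finrank_le_choose_two)

/-- ★ **One `3`-block ⇒ `V' = HULL(W₀, W₁, W₂)` with full outer blocks and a plane in the middle.** [val-idea-30 MEMO codim-one, COROLLARY II (β)] -/
theorem hull_of_deficiency_le_one {m a₀ a₂ : ℕ} (c : Fin m → ℕ) (hc : ∀ i, c i ≤ 2)
    (e₀ : {i : Fin m // c i = 0} ≃ Fin a₀) (e₁ : {i : Fin m // c i = 1} ≃ Fin 3) (e₂ : {i : Fin m // c i = 2} ≃ Fin a₂)
    (V' : Submodule ℂ (Matrix (Fin m) (Fin m) ℂ)) (hblock : ∀ A ∈ V', ∀ i j, c i < c j → A i j = 0)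
    (W₀ : Submodule ℂ (Matrix (Fin a₀) (Fin a₀) ℂ)) (W₁ : Submodule ℂ (Matrix (Fin 3) (Fin 3) ℂ))
    (W₂ : Submodule ℂ (Matrix (Fin a₂) (Fin a₂) ℂ))
    (h₀ : ∀ A ∈ V', Matrix.reindex e₀ e₀ (A.toBlock (fun i => c i = 0) (fun i => c i = 0)) ∈ W₀)
    (h₁ : ∀ A ∈ V', Matrix.reindex e₁ e₁ (A.toBlock (fun i => c i = 1) (fun i => c i = 1)) ∈ W₁)
    (h₂ : ∀ A ∈ V', Matrix.reindex e₂ e₂ (A.toBlock (fun i => c i = 2) (fun i => c i = 2)) ∈ W₂)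
    (hW₀ : ∀ X ∈ W₀, IsNilpotent X) (hW₁ : Module.finrank ℂ W₁ ≤ 2) (hW₂ : ∀ X ∈ W₂, IsNilpotent X)
    (hdim : m.choose 2 ≤ Module.finrank ℂ V' + 1) :
    Module.finrank ℂ W₀ = a₀.choose 2 ∧ Module.finrank ℂ W₂ = a₂.choose 2 ∧ Module.finrank ℂ W₁ = 2 ∧
      Module.finrank ℂ V' + 1 = m.choose 2 ∧
      ∀ M : Matrix (Fin m) (Fin m) ℂ, M ∈ V' ↔ (∀ i j, c i < c j → M i j = 0) ∧
        Matrix.reindex e₀ e₀ (M.toBlock (fun i => c i = 0) (fun i => c i = 0)) ∈ W₀ ∧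
        Matrix.reindex e₁ e₁ (M.toBlock (fun i => c i = 1) (fun i => c i = 1)) ∈ W₁ ∧
        Matrix.reindex e₂ e₂ (M.toBlock (fun i => c i = 2) (fun i => c i = 2)) ∈ W₂ := by
  have hcount := finrank_le_of_three_levels c hc e₀ e₁ e₂ V' hblock W₀ W₁ W₂ h₀ h₁ h₂
  have harith := choose_two_eq_three_levels c hc
  have hc0 : Fintype.card {i : Fin m // c i = 0} = a₀ := by rw [Fintype.card_congr e₀, Fintype.card_fin]
  have hc1 : Fintype.card {i : Fin m // c i = 1} = 3 := by rw [Fintype.card_congr e₁, Fintype.card_fin]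
  have hc2 : Fintype.card {i : Fin m // c i = 2} = a₂ := by rw [Fintype.card_congr e₂, Fintype.card_fin]
  rw [hc0, hc1, hc2, show (3 : ℕ).choose 2 = 3 from rfl] at harith
  have hG₀ := finrank_le_choose_two a₀ W₀ hW₀
  have hG₂ := finrank_le_choose_two a₂ W₂ hW₂
  have hf₀ : Module.finrank ℂ W₀ = a₀.choose 2 := by omega
  have hf₂ : Module.finrank ℂ W₂ = a₂.choose 2 := by omega
  have hf₁ : Module.finrank ℂ W₁ = 2 := by omega
  refine ⟨hf₀, hf₂, hf₁, by omega, fun M => ?_⟩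
  exact mem_iff_of_three_levels c hc e₀ e₁ e₂ V' hblock W₀ W₁ W₂ h₀ h₁ h₂ (by omega) M

end Summit.ValiantsHypothesis.ValiantsHypothesis.Theorems.GrenetZeon.HeavyTopCodimOneHull

end
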